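import Literature.RepresentationTheory.MoeglinVignerasWaldspurger1987.RankOneThetaDichotomy
import HarnessLib

/-!
# Complementary type sets of two rank-one oscillator representations from the character relation `tr ω₂ = -tr ω₁`
# off `{±1}` (the `(U(1), U(1))` theta dichotomy WITH TRIVIAL SHIFT, read from a finite-level trace identity)

[MoeglinVignerasWaldspurger1987] C. Mœglin, M.-F. Vignéras, J.-L. Waldspurger, LNM 1291 (1987), Chap. 3 §IV.4 Théorème principal;
Chap. 2 II.1 (A), II.8.  Topic `RepresentationTheory/MoeglinVignerasWaldspurger1987`; namespace
`Literature.RepresentationTheory.MoeglinVignerasWaldspurger1987` (that of ★ `RankOneThetaDichotomy`).  THEOREMS ONLY (no definition, no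
named fact, no `sorry`, no instance, no notation).  Cell hodgecm-mathlib, half-A line LD2 (R₂ organ road, glue §2);
`--supports stmt-HodgeConjecture-24832`.

SETTING: that of ★ `RankOneThetaDichotomy` — the compact torus `T = U(J₁)(F_v) = E_v¹` at a non-split finite place `v`, two trace-zero
`δ₁, δ₂` and two sections `s₁` over `ι_{δ₁}`, `s₂` over `ι_{δ₂}` of the metaplectic cover `S̃p(𝕎_v)` (`t` a `1 × 1` Gram
matrix), with `ω_{sᵢ} = (MpPsi.toRep (localSchrodinger F 1 t v)).comp sᵢ` smooth.  NO class hypothesis on `δ₂/δ₁` is needed here.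

* **`rankOne_finrank_weightSpace_add_eq_one_of_trace_eq_neg`** — IF every `z ∉ {1, -1}` has a neighbourhood `z K₀` on which, for every
  open `L ≤ K₀`, `tr(ω_{s₂}(u) | 𝒮^L) = - tr(ω_{s₁}(u) | 𝒮^L)` (the character relation of ★ `rankOne_theta_character_ratio` with the
  dichotomy character PINNED TO `1`), THEN `dim ω_{s₁}[ξ] + dim ω_{s₂}[ξ] = 1` for every open-kernel `ξ`: the type sets of `ω_{s₁}` and
  `ω_{s₂}` are literally COMPLEMENTARY.  Proof = that of ★ `rankOne_theta_dichotomy` with the relation supplied instead of produced: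
  ★ `TwistedCoinv.finrank_weightSpace_add_eq_one_of_trace_eq_neg` fed with multiplicity one (★ `finiteDimensional_weightSpace_rankOne`) and the
  reflection asymmetry (★ `rankOne_reflection_asymmetry`).
* **`rankOne_coinv_complement_of_trace_eq_neg`** — the same in the coinvariant currency of the see-saw files: no open-kernel `ξ` has BOTH
  `Coinv_ξ(ω_{s₁}) ≠ 0` and `Coinv_ξ(ω_{s₂}) ≠ 0` (★ `exists_linearEquiv_weightSpace_coinv`).  This is exactly the hypothesis `hcomp` of
  `rankOne_theta_lines_disjoint_of_blockComplement` (sibling file `RankOneThetaLiftLinesDisjointOfBlockComplement`) at the block-0 sections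
  `restrictLeft sᵢ` (which lie over `ι^{T₁}_{δᵢ}` by ★ `proj_restrictLeft` and are smooth by ★ `isSmooth_restrictLeft`).

WHY: for the two CM θ-package sections of lines `a`, `a′` at the SAME splitting character the relation `tr ω₂ = -tr ω₁` is the predicted
big-cell identity (organ (P′) of the LD2 line; [HarrisKudlaSweet1996, Thm. 6.1], [SunZhu2014, Thm. 1.10] conservation `m⁺ + m⁻ = 4` for `U(1)`);
this file turns that ONE identity into block-0 complementarity with no further input (no uniqueness of the dichotomy character is needed).
HC_CM is proved only modulo the 7 printed citations (2 remaining: hLiu418 = stmt-HodgeConjecture-24832, h413 = stmt-HodgeConjecture-24833) until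
rung 0 closes; count-neutral.

## References
* [MoeglinVignerasWaldspurger1987] LNM 1291 (1987), Chap. 3 §IV.4 Théorème principal; Chap. 2 II.1 (A), II.8.
* [Weil1964] A. Weil, Acta Math. 111 (1964) 143–211, Chap. I n° 14.
* [BernsteinZelevinsky1976] I. N. Bernstein, A. V. Zelevinsky, Russian Math. Surveys 31 (1976), §2.1–2.3.
* [HarrisKudlaSweet1996] M. Harris, S. Kudla, W. J. Sweet, J. AMS 9 (1996), Thm. 6.1, Cor. 4.4.
* [SunZhu2014] B. Sun, C.-B. Zhu, J. AMS 28 (2015), Thm. 1.10.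
-/

set_option autoImplicit false

noncomputable section

open NumberField IsDedekindDomain Matrix MeasureTheory
open scoped Matrix MatrixGroups NNReal Topology
open Literature.RepresentationTheory Literature.RepresentationTheory.HeisenbergGroup
open Literature.RepresentationTheory.TwistedCoinv
open Literature.NumberTheory.GelbartRogawski1991.UnitaryDualPair.LocalSplitting
open Literature.NumberTheory.Automorphic Literature.NumberTheory.Automorphic.UnitaryGroup
open Literature.NumberTheory.Automorphic.Liu2021
open Literature.NumberTheory.GaloisRepresentations.IsNonarchimedeanLocalField
open Literature.NumberTheory.Weil1964 Literature.NumberTheory.QuadraticForms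

namespace Literature.RepresentationTheory.MoeglinVignerasWaldspurger1987

variable (F : Type) [Field F] [NumberField F] (E : Type) [Field E] [NumberField E] [Algebra F E]
  [Algebra.IsQuadraticExtension F E] (c : E ≃ₐ[F] E)
  (δ₁ : E) (hcδ₁ : c δ₁ = -δ₁) (hδ₁ : δ₁ ≠ 0) (d₁ : F) (hd₁ : δ₁ * δ₁ = algebraMap F E d₁)
  (δ₂ : E) (hcδ₂ : c δ₂ = -δ₂) (hδ₂ : δ₂ ≠ 0) (d₂ : F) (hd₂ : δ₂ * δ₂ = algebraMap F E d₂)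
  (t : Matrix (Fin 1) (Fin 1) F) (ht : t.IsSymm) (htd : IsUnit t.det)
  (J₁ : Matrix (Fin 1) (Fin 1) E) (hJ₁ : J₁ = t.map (algebraMap F E)) (v : HeightOneSpectrum (𝓞 F))
  (hE : IsField (UnitaryGroup.LocalRing E v))
  (s₁ : localPi E c 1 J₁ v →* LocalMp F 1 t v)
  (hs₁ : ∀ g, MpPsi.proj _ (s₁ g) = iota F E c 1 hcδ₁ hδ₁ hd₁ t ht hJ₁ v g)
  (hsm₁ : Representation.IsSmooth ((MpPsi.toRep (localSchrodinger F 1 t v)).comp s₁))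
  (s₂ : localPi E c 1 J₁ v →* LocalMp F 1 t v)
  (hs₂ : ∀ g, MpPsi.proj _ (s₂ g) = iota F E c 1 hcδ₂ hδ₂ hd₂ t ht hJ₁ v g)
  (hsm₂ : Representation.IsSmooth ((MpPsi.toRep (localSchrodinger F 1 t v)).comp s₂))

include hcδ₁ hδ₁ hd₁ hcδ₂ hδ₂ hd₂ ht htd hJ₁ hE hs₁ hsm₁ hs₂ hsm₂ in
/-- **COMPLEMENTARY TYPE SETS FROM `tr ω₂ = -tr ω₁` OFF `{±1}`** (the `(U(1), U(1))` theta dichotomy with trivial shift).  If every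
`z ∉ {1, -1}` of `U(J₁)(F_v)` has an open `K₀` with `tr(ω_{s₂}(u) | 𝒮^L) = -tr(ω_{s₁}(u) | 𝒮^L)` for all `u ∈ z K₀` and all
open `L ≤ K₀`,
then `dim ω_{s₁}[ξ] + dim ω_{s₂}[ξ] = 1` for every open-kernel character `ξ` (any auxiliary Haar measure `μ` and conductor exponent `m` of
`ψ_v` may be supplied). [cite: MoeglinVignerasWaldspurger1987, Chap. 3 §IV.4 Théorème principal] -/
theorem rankOne_finrank_weightSpace_add_eq_one_of_trace_eq_neg [MeasurableSpace (v.adicCompletion F)] [BorelSpace (v.adicCompletion F)]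
    (μ : Measure (v.adicCompletion F)) [μ.IsAddHaarMeasure] (m : ℤ) (hm : (adeleAddCharAt F v).HasConductorExp m)
    (hrel : ∀ z : localPi E c 1 J₁ v, z ≠ 1 → z ≠ localUnitScalar E c J₁ v (-1) (negOne_mul_conjLocal_negOne E c v) →
      ∃ K₀ : Subgroup (localPi E c 1 J₁ v), IsOpen (K₀ : Set (localPi E c 1 J₁ v)) ∧
        ∀ u : localPi E c 1 J₁ v, z⁻¹ * u ∈ K₀ →
          ∀ L : Subgroup (localPi E c 1 J₁ v), IsOpen (L : Set (localPi E c 1 J₁ v)) → L ≤ K₀ →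
            LinearMap.trace ℂ (Representation.fixedPoints ((MpPsi.toRep (localSchrodinger F 1 t v)).comp s₂) L)
                ((((MpPsi.toRep (localSchrodinger F 1 t v)).comp s₂) u).restrict
                  (apply_mem_fixedPoints_of_comm ((MpPsi.toRep (localSchrodinger F 1 t v)).comp s₂)
                    (localPi_one_mul_comm E c J₁ v) L u)) =
              -(LinearMap.trace ℂ (Representation.fixedPoints ((MpPsi.toRep (localSchrodinger F 1 t v)).comp s₁) L)
                  ((((MpPsi.toRep (localSchrodinger F 1 t v)).comp s₁) u).restrict
                    (apply_mem_fixedPoints_of_comm ((MpPsi.toRep (localSchrodinger F 1 t v)).comp s₁)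
                      (localPi_one_mul_comm E c J₁ v) L u))))
    (ξ : localPi E c 1 J₁ v →* ℂˣ) (hξ : IsOpen (ξ.ker : Set (localPi E c 1 J₁ v))) :
    Module.finrank ℂ (weightSpace ((MpPsi.toRep (localSchrodinger F 1 t v)).comp s₁) id (fun k => ((ξ k : ℂˣ) : ℂ))) +
      Module.finrank ℂ (weightSpace ((MpPsi.toRep (localSchrodinger F 1 t v)).comp s₂) id (fun k => ((ξ k : ℂˣ) : ℂ))) = 1 := by
  haveI : CompactSpace (localPi E c 1 J₁ v) := compactSpace_localPi_rankOne F E c hcδ₁ hδ₁ htd hJ₁ v hE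
  -- multiplicity one for both oscillator representations
  have hfin₁ : ∀ χ : localPi E c 1 J₁ v →* ℂˣ, IsOpen (χ.ker : Set (localPi E c 1 J₁ v)) →
      Module.Finite ℂ (weightSpace ((MpPsi.toRep (localSchrodinger F 1 t v)).comp s₁) id (fun k => ((χ k : ℂˣ) : ℂ))) ∧
        Module.finrank ℂ (weightSpace ((MpPsi.toRep (localSchrodinger F 1 t v)).comp s₁) id
          (fun k => ((χ k : ℂˣ) : ℂ))) ≤ 1 := fun χ hχ =>
    finiteDimensional_weightSpace_rankOne F E c hcδ₁ hδ₁ hd₁ ht htd hJ₁ v hE s₁ hs₁ hsm₁ χ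
      (norm_apply_eq_one_of_isOpen_ker_rankOne F E c hcδ₁ hδ₁ htd hJ₁ v hE χ hχ)
      (continuous_apply_of_isOpen_ker_rankOne F E c htd hJ₁ v χ hχ)
  have hfin₂ : ∀ χ : localPi E c 1 J₁ v →* ℂˣ, IsOpen (χ.ker : Set (localPi E c 1 J₁ v)) →
      Module.Finite ℂ (weightSpace ((MpPsi.toRep (localSchrodinger F 1 t v)).comp s₂) id (fun k => ((χ k : ℂˣ) : ℂ))) ∧
        Module.finrank ℂ (weightSpace ((MpPsi.toRep (localSchrodinger F 1 t v)).comp s₂) id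
          (fun k => ((χ k : ℂˣ) : ℂ))) ≤ 1 := fun χ hχ =>
    finiteDimensional_weightSpace_rankOne F E c hcδ₂ hδ₂ hd₂ ht htd hJ₁ v hE s₂ hs₂ hsm₂ χ
      (norm_apply_eq_one_of_isOpen_ker_rankOne F E c hcδ₂ hδ₂ htd hJ₁ v hE χ hχ)
      (continuous_apply_of_isOpen_ker_rankOne F E c htd hJ₁ v χ hχ)
  -- the reflection asymmetry of `ω_{s₁}`, read on `W = 𝒮^L`
  have R := rankOne_reflection_asymmetry F E c δ₁ hcδ₁ hδ₁ d₁ hd₁ t ht htd J₁ hJ₁ v hE s₁ hs₁ hsm₁ μ m hm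
  have hasym : ∃ z : localPi E c 1 J₁ v, ∃ K₀ : Subgroup (localPi E c 1 J₁ v), IsOpen (K₀ : Set (localPi E c 1 J₁ v)) ∧
      z ∉ K₀ ∧ localUnitScalar E c J₁ v (-1) (negOne_mul_conjLocal_negOne E c v) * z ∉ K₀ ∧
      ∀ L : Subgroup (localPi E c 1 J₁ v), IsOpen (L : Set (localPi E c 1 J₁ v)) → L ≤ K₀ →
        ‖LinearMap.trace ℂ (Representation.fixedPoints ((MpPsi.toRep (localSchrodinger F 1 t v)).comp s₁) L)
            ((((MpPsi.toRep (localSchrodinger F 1 t v)).comp s₁)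
                (localUnitScalar E c J₁ v (-1) (negOne_mul_conjLocal_negOne E c v) * z)).restrict
              (apply_mem_fixedPoints_of_comm ((MpPsi.toRep (localSchrodinger F 1 t v)).comp s₁) (localPi_one_mul_comm E c J₁ v) L
                (localUnitScalar E c J₁ v (-1) (negOne_mul_conjLocal_negOne E c v) * z)))‖ ≠
          ‖LinearMap.trace ℂ (Representation.fixedPoints ((MpPsi.toRep (localSchrodinger F 1 t v)).comp s₁) L)
            ((((MpPsi.toRep (localSchrodinger F 1 t v)).comp s₁) z).restrict
              (apply_mem_fixedPoints_of_comm ((MpPsi.toRep (localSchrodinger F 1 t v)).comp s₁) (localPi_one_mul_comm E c J₁ v) L z))‖ := by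
    refine ⟨R.choose, R.choose_spec.choose, R.choose_spec.choose_spec.1, R.choose_spec.choose_spec.2.1,
      R.choose_spec.choose_spec.2.2.1, fun L hLo hLK => ?_⟩
    haveI : FiniteDimensional ℂ (Representation.fixedPoints ((MpPsi.toRep (localSchrodinger F 1 t v)).comp s₁) L) :=
      finite_fixedPoints_of_finite_weightSpace _ (localPi_one_mul_comm E c J₁ v) L hLo fun χ hχ => (hfin₁ χ (Subgroup.isOpen_mono hχ hLo)).1
    exact R.choose_spec.choose_spec.2.2.2 L hLo hLK _ (fun f => Representation.mem_fixedPoints _ L f) _ _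
  -- the trivial shift, as a scalar
  have h1 : ∀ u : localPi E c 1 J₁ v, ((((1 : localPi E c 1 J₁ v →* ℂˣ) u : ℂˣ) : ℂ)) = 1 := fun u => by
    rw [MonoidHom.one_apply, Units.val_one]
  -- the abstract dichotomy engine at the trivial shift `θ = 1`
  have key := finrank_weightSpace_add_eq_one_of_trace_eq_neg
    ((MpPsi.toRep (localSchrodinger F 1 t v)).comp s₁) ((MpPsi.toRep (localSchrodinger F 1 t v)).comp s₂)
    (localPi_one_mul_comm E c J₁ v) hfin₁ hfin₂ (localUnitScalar_negOne_mul_self E c J₁ v) 1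
    (by rw [MonoidHom.ker_one, Subgroup.coe_top]; exact isOpen_univ)
    (fun z hz hz' => (hrel z hz hz').imp fun K₀ hK => ⟨hK.1, fun u hu L hLo hLK =>
      (hK.2 u hu L hLo hLK).trans
        (congrArg Neg.neg ((one_mul _).symm.trans (congrArg (fun r : ℂ => r * _) (h1 u).symm)))⟩)
    hasym ξ hξ
  exact (congrArg (fun η : localPi E c 1 J₁ v →* ℂˣ =>
      Module.finrank ℂ (weightSpace ((MpPsi.toRep (localSchrodinger F 1 t v)).comp s₁) id (fun k => ((ξ k : ℂˣ) : ℂ))) +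
        Module.finrank ℂ (weightSpace ((MpPsi.toRep (localSchrodinger F 1 t v)).comp s₂) id (fun k => ((η k : ℂˣ) : ℂ))) = 1)
    (mul_one ξ)).mp key

include hcδ₁ hδ₁ hd₁ hcδ₂ hδ₂ hd₂ ht htd hJ₁ hE hs₁ hsm₁ hs₂ hsm₂ in
/-- **The same in coinvariant currency: BLOCK-0 COMPLEMENTARITY.**  Under the relation `tr ω₂ = -tr ω₁` off `{±1}`, no open-kernel character
`ξ` has both `Coinv_ξ(ω_{s₁}) ≠ 0` and `Coinv_ξ(ω_{s₂}) ≠ 0` (★ `exists_linearEquiv_weightSpace_coinv`: for a smooth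
representation of the
compact torus the `ξ`-coinvariants are the `ξ`-weight space). [cite: MoeglinVignerasWaldspurger1987, Chap. 3 §IV.4 Théorème principal]
[cite: BernsteinZelevinsky1976, §2.3] -/
theorem rankOne_coinv_complement_of_trace_eq_neg [MeasurableSpace (v.adicCompletion F)] [BorelSpace (v.adicCompletion F)]
    (μ : Measure (v.adicCompletion F)) [μ.IsAddHaarMeasure] (m : ℤ) (hm : (adeleAddCharAt F v).HasConductorExp m)
    (hrel : ∀ z : localPi E c 1 J₁ v, z ≠ 1 → z ≠ localUnitScalar E c J₁ v (-1) (negOne_mul_conjLocal_negOne E c v) →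
      ∃ K₀ : Subgroup (localPi E c 1 J₁ v), IsOpen (K₀ : Set (localPi E c 1 J₁ v)) ∧
        ∀ u : localPi E c 1 J₁ v, z⁻¹ * u ∈ K₀ →
          ∀ L : Subgroup (localPi E c 1 J₁ v), IsOpen (L : Set (localPi E c 1 J₁ v)) → L ≤ K₀ →
            LinearMap.trace ℂ (Representation.fixedPoints ((MpPsi.toRep (localSchrodinger F 1 t v)).comp s₂) L)
                ((((MpPsi.toRep (localSchrodinger F 1 t v)).comp s₂) u).restrict
                  (apply_mem_fixedPoints_of_comm ((MpPsi.toRep (localSchrodinger F 1 t v)).comp s₂)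
                    (localPi_one_mul_comm E c J₁ v) L u)) =
              -(LinearMap.trace ℂ (Representation.fixedPoints ((MpPsi.toRep (localSchrodinger F 1 t v)).comp s₁) L)
                  ((((MpPsi.toRep (localSchrodinger F 1 t v)).comp s₁) u).restrict
                    (apply_mem_fixedPoints_of_comm ((MpPsi.toRep (localSchrodinger F 1 t v)).comp s₁)
                      (localPi_one_mul_comm E c J₁ v) L u))))
    (ξ : localPi E c 1 J₁ v →* ℂˣ) (hξ : IsOpen (ξ.ker : Set (localPi E c 1 J₁ v)))
    (h₁ : Nontrivial (Coinv ((MpPsi.toRep (localSchrodinger F 1 t v)).comp s₁) ξ))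
    (h₂ : Nontrivial (Coinv ((MpPsi.toRep (localSchrodinger F 1 t v)).comp s₂) ξ)) : False := by
  have key := rankOne_finrank_weightSpace_add_eq_one_of_trace_eq_neg F E c δ₁ hcδ₁ hδ₁ d₁ hd₁ δ₂ hcδ₂ hδ₂ d₂ hd₂ t ht htd
    J₁ hJ₁ v hE s₁ hs₁ hsm₁ s₂ hs₂ hsm₂ μ m hm hrel ξ hξ
  haveI : CompactSpace (localPi E c 1 J₁ v) := compactSpace_localPi_rankOne F E c hcδ₁ hδ₁ htd hJ₁ v hE
  -- the coinvariants are the weight spaces (smooth representation of a compact group, open kernel)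
  obtain ⟨e₁, -⟩ := exists_linearEquiv_weightSpace_coinv ((MpPsi.toRep (localSchrodinger F 1 t v)).comp s₁) ξ hsm₁ hξ
  obtain ⟨e₂, -⟩ := exists_linearEquiv_weightSpace_coinv ((MpPsi.toRep (localSchrodinger F 1 t v)).comp s₂) ξ hsm₂ hξ
  haveI := e₁.toEquiv.nontrivial
  haveI := e₂.toEquiv.nontrivial
  haveI := (finiteDimensional_weightSpace_rankOne F E c hcδ₁ hδ₁ hd₁ ht htd hJ₁ v hE s₁ hs₁ hsm₁ ξ
      (norm_apply_eq_one_of_isOpen_ker_rankOne F E c hcδ₁ hδ₁ htd hJ₁ v hE ξ hξ)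
      (continuous_apply_of_isOpen_ker_rankOne F E c htd hJ₁ v ξ hξ)).1
  haveI := (finiteDimensional_weightSpace_rankOne F E c hcδ₂ hδ₂ hd₂ ht htd hJ₁ v hE s₂ hs₂ hsm₂ ξ
      (norm_apply_eq_one_of_isOpen_ker_rankOne F E c hcδ₂ hδ₂ htd hJ₁ v hE ξ hξ)
      (continuous_apply_of_isOpen_ker_rankOne F E c htd hJ₁ v ξ hξ)).1
  have p₁ := (Module.finrank_pos_iff (R := ℂ)
    (M := weightSpace ((MpPsi.toRep (localSchrodinger F 1 t v)).comp s₁) id (fun k => ((ξ k : ℂˣ) : ℂ)))).2 ‹_›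
  have p₂ := (Module.finrank_pos_iff (R := ℂ)
    (M := weightSpace ((MpPsi.toRep (localSchrodinger F 1 t v)).comp s₂) id (fun k => ((ξ k : ℂˣ) : ℂ)))).2 ‹_›
  omega

end Literature.RepresentationTheory.MoeglinVignerasWaldspurger1987

end
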